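import Literature.NumberTheory.QuadraticFields.ClassGroupThetaBinaryForms
import Literature.NumberTheory.LFunctions.ConreyIwaniec2002ThetaVoronoiDefs
import HarnessLib

/-!
# Conrey–Iwaniec (2002), (2.15)–(2.17): the class-group theta series `θ(z;ψ)` as one half of a
# `ψ̄`-weighted sum of binary theta series over the reduced forms

B. Conrey, H. Iwaniec, *Spacing of zeros of Hecke `L`-functions and the class number problem*,
Acta Arith. 103 (2002) 259–312, §2 [held text `paper:arxiv-math_0111012`, p0006]:
"`θ_𝒜(z) = ½ + Σ_{𝔞∈𝒜} e(zN𝔞)` (2.14) … This theta function is also given by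
`θ_𝒜(z) = ½ Σ_m Σ_n e(zφ_𝒜(m,n))` (2.15) where `φ_𝒜(x,y) = ax² + bxy + cy²` is the corresponding
quadratic form … `θ(z;ψ) = Σ_{𝒜 ∈ Cl(K)} ψ(𝒜)θ_𝒜(z)` (2.16) … has the Fourier expansion
`θ(z;ψ) = Σ_{n ≥ 0} λ_ψ(n)e(nz)` (2.17)" with `λ_ψ(0) = δ_ψ h/2`, `λ_ψ(n) = Σ_{N𝔞 = n} ψ(𝔞)` (2.18).

In the vocabulary of the cell `landau-siegel/ls-inputs` (line `theta-voronoi`, the registered stub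
V1 `stub_theta_omega` of SUB-SKELETON S3d): the `q`-expansion value
`thetaValue (twistCount K ν_ψ) (thetaConst K ψ) x y = ½Σ_𝒜ψ(𝒜) + Σ_{n≥1} λ_ψ(n)e(nx)e^{−2πny}`
(`ConreyIwaniec2002ThetaVoronoiDefs`) IS `θ(x + iy; ψ)` of (2.17), and this file PROVES

* `thetaValue_twistCount_eq_half_sum_binaryTheta` —
  `θ(x+iy;ψ) = ½ Σ_{Q ∈ reducedForms d_K} ψ([𝔞_Q])⁻¹ · Σ_{(u,v) ∈ ℤ²} e((x+iy)Q(u,v))`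
  for an imaginary quadratic `K` with `d_K = t² + 4m < −4` in the coordinates of an integral basis
  `(1, ω)`, `ω² = m + tω` (`𝔞_Q = (A, ω − (B+t)/2)` the ideal of the reduced form `Q = (A, B, C)`,
  `[𝔞] = [𝔞_Q]⁻¹` for the ideals counted against `Q`, whence the inverse = `ψ̄([𝔞_Q])`),

a direct transcription of the tree's generic
`Literature.NumberTheory.QuadraticFields.Quadratic.half_sum_add_tsum_twistCount_cexp_eq`
(`ClassGroupThetaBinaryForms.lean`) with `τ = x + iy`, `e(nx)e^{−2πny} = e(nτ)`. It is the entry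
point of the binary-theta-series route to the `ω`-transformation law of `θ(·;ψ)` (V1): every
statement about `θ(·;ψ)|_ω` is, by linearity, a statement about the congruent binary theta series
`Σ_{(u,v)} e(zQ(u,v))` of the `h` reduced forms. Nothing about that transformation law is asserted
here. «The programme SEARCHES and TYPES; no claim about Landau–Siegel zeros, Theorems 1–2 of
arXiv:2211.02515 or a repaired Margin232 until a kernel theorem says so.»

## References

* [ConreyIwaniec2002] B. Conrey, H. Iwaniec, Acta Arith. 103 (2002) 259–312, §2 (2.14)–(2.18).
* [Cox2013] D. A. Cox, *Primes of the form x² + ny²*, 2nd ed. (2013), §7.B Thm. 7.7.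
-/

noncomputable section

open scoped NumberField FourierTransform
open Complex Module NumberField Ideal
open Literature.NumberTheory.QuadraticFields.BinaryQuadraticForm (reducedForms)
open Literature.NumberTheory.QuadraticFields.Quadratic

namespace Literature.NumberTheory.LFunctions

namespace ConreyIwaniec2002

open NumberField Literature.NumberTheory.LFunctions.NumberField

variable {K : Type*} [Field K] [NumberField K]

/-- `e(sx)·e^{−2πsy} = e(s(x+iy))` as complex exponentials (private bookkeeping). [folklore] -/
private theorem fourierChar_mul_exp_eq_cexp (s x y : ℝ) :
    (𝐞 (s * x) : ℂ) * (Real.exp (-(2 * Real.pi * s * y)) : ℂ) =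
      cexp (2 * Real.pi * I * ((x : ℂ) + y * I) * (s : ℂ)) := by
  rw [Real.fourierChar_apply, Complex.ofReal_exp, ← Complex.exp_add]
  congr 1
  push_cast
  have hI : I * I = -1 := Complex.I_mul_I
  linear_combination (-(2 : ℂ) * (Real.pi : ℂ) * s * y) * hI

/-- **`θ(x+iy;ψ) = ½ Σ_{Q ∈ reducedForms d_K} ψ([𝔞_Q])⁻¹ Σ_{(u,v) ∈ ℤ²} e((x+iy)Q(u,v))`**
(Conrey–Iwaniec (2.15)–(2.17) combined): for an imaginary quadratic field `K` with integral basis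
`(1, ω)`, `ω² = m + tω`, `d_K = t² + 4m < −4`, a class group character `ψ`, `x ∈ ℝ` and `y > 0`,
the `q`-expansion value `thetaValue (twistCount K ν_ψ) (thetaConst K ψ) x y =
½Σ_𝒜ψ(𝒜) + Σ_{n≥1}λ_ψ(n)e(nx)e^{−2πny}` (= `θ(x+iy;ψ)` by (2.17), `λ_ψ(0) = δ_ψh/2 = ½Σ_𝒜ψ(𝒜)`)
equals `Σ_𝒜 ψ(𝒜)θ_𝒜(x+iy)` written through (2.15) with the classes enumerated by the reduced forms
(`reducedForms_mk0_bijective`; the ideals counted against `Q` form the class `[𝔞_Q]⁻¹`).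
[cite: ConreyIwaniec2002, §2 (2.15)–(2.17)] -/
theorem thetaValue_twistCount_eq_half_sum_binaryTheta (b : Basis (Fin 2) ℤ (𝓞 K)) (hb : b 0 = 1)
    {t m : ℤ} (hω : b 1 * b 1 = (m : 𝓞 K) + (t : 𝓞 K) * b 1) (hD : t ^ 2 + 4 * m < -4)
    (ψ : ClassGroup (𝓞 K) →* ℂˣ) (x : ℝ) {y : ℝ} (hy : 0 < y) :
    thetaValue (twistCount K (classGroupCharIdealHom ψ)) (thetaConst K ψ) x y =
      1 / 2 * ∑ Q ∈ reducedForms (t ^ 2 + 4 * m),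
        (classGroupCharIdealHom ψ
            (span {(Q.1 : 𝓞 K), b 1 - (((Q.2.1 + t) / 2 : ℤ) : 𝓞 K)}))⁻¹ *
          ∑' p : ℤ × ℤ, cexp (2 * Real.pi * I * ((x : ℂ) + y * I) *
            ((Q.1 * p.1 ^ 2 + Q.2.1 * p.1 * p.2 + Q.2.2 * p.2 ^ 2 : ℤ) : ℂ)) := by
  have hτ : 0 < ((x : ℂ) + y * I).im := by simpa using hy
  rw [← half_sum_add_tsum_twistCount_cexp_eq b hb hω hD ψ hτ, thetaValue, thetaConst]
  congr 1
  refine tsum_congr fun n => ?_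
  rw [mul_assoc, fourierChar_mul_exp_eq_cexp]
  push_cast
  ring_nf

end ConreyIwaniec2002

end Literature.NumberTheory.LFunctions

end
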